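import Literature.AlgebraicGeometry.ModuliOfAbelianVarieties.SiegelUniversalFamilyUniformisation
import Literature.AlgebraicGeometry.ShimuraVarieties.UnitaryBallUniformisationLocalSectionAnalytification
import Literature.AlgebraicGeometry.Motives.VarietiesProperProofs
import HarnessLib

/-!
# COV-2 «UNIV-FAMILY CHART COVER OF A PIECE»: the ★ P-3 uniformisation of the pulled-back universal Siegel family over a disc-quotient
# piece, instantiated on EVERY section domain of the ball uniformisation — the chart-cover input of ★ E6-an′
# ([Lange2023AbelianVarietiesComplex] §3.4 Prop. 3.4.1, Lemma 3.4.7, Prop. 3.4.8; [BergeronMillsonMoeglin2016Balls] Introduction §1.1)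

Topic `Literature/AlgebraicGeometry/ModuliOfAbelianVarieties`; namespace `Literature.AlgebraicGeometry.ModuliOfAbelianVarieties`.
THEOREMS ONLY (no definition, no named fact, no instance, no notation, no `sorry`); the named fact ★ P-3
`siegelUniversalFamilyUniformisation` is an explicit HYPOTHESIS `(hP3 : siegelUniversalFamilyUniformisation)` (D-0014), never assumed.
Cell `hodgecm-mathlib` (D-0151), FLOOR 0, P6 «MOD» (crux hLiu418 = stmt-HodgeConjecture-24832, `--supports`), E6 closer of
`Cruxes/HLiu418/Lines/F0_P6a_PELWitnessE.lean`, socket Σ-AN `ReadsCReading`, census row **COV-2** (A-p06 (g33) `CENSUS-SigmaAN.v1`, deal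
00:58:26Z: «ONE per-piece organ whose OUTPUT is EXACTLY the hypothesis list of ★ E6-an′ `exists_isMonHom_of_chartReadings_of_additive` at
`(S := X_q, A := P_{X_q}.A)`»).  HC_CM is proved only modulo the printed citations (2 remaining named inputs hLiu418 24832, h413 24833)
until rung 0 closes; this file is generic and changes no count.

THE MATHEMATICS.  `T = X_q` a compact disc quotient (`B : UnitaryBallUniformisationDatum 1 T`, cone of `J_c = J⋆^{ι₁}`), `ψ : T ⟶ S_c` its
slice morphism into a uniformised piece `(S_c, ι_c, unif_c)` of `𝓐_{g,δ,N} ⊗ ℂ` with holomorphic Siegel lift `Z` on the cone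
(`unif_c (Z v) = ψ (unif_B v)`, ★ E6-fac), `P_T := 𝓐_univ ×_𝓜 T`, analytifications `φT : MT → T(ℂ)` (charts on `ℂ`), `φA : MA → P_T.A(ℂ)`.
Through every point `i` of `MT` there is a holomorphic local section `σ_i` of `unif_B` on an open `U_i ∋ i` (★
`UnitaryBallUniformisationDatum.exists_siegelLift_nhds_of_isAnalytification`: proper discontinuity + Clements–Osgood), hence a holomorphic lift
`s_i := Z ∘ σ_i : U_i → 𝔥_g` of `ψ^an` through `unif_c`; ★ P-3 ([Lange2023AbelianVarietiesComplex] §3.4: the universal family over an evenly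
covered open IS the tautological torus family `(W × ℂ^g)∕Π_{s(w)}ℤ^{2g}`, pulled back along `ψ` by [SGA1] XII 1.2) then gives on EACH `U_i` a
relative exponential chart `(Φ_i, ex_i)` of `P_T.A^an → T^an` with the tautological period family `Φ_i t = Π_{Z (σ_i t)}`, additive fibre
analytifications ((G)) and ADMISSIBLE fibre markings by `[J(Z (σ_i t)), r]` with unit frame, tautological coordinates and torus map `=` chart
fibre map ((ADM)).  Indexing the charts by the points `i : MT` (so `i ∈ U_i` is the cover clause `hcov` of ★ E6-an′), this file returns
the whole list at once.

* §1 **`exists_univFamilyChartCover_of_piece`** — THE HEAD (hypotheses = the ★ P-3 binder list VERBATIM through `(MA, φA, hA)`, then the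
  piece's ball datum `B`, `hB : B.Hℂ = J_c`, the lift `Z` with `Z_hol`∕`Z_mem`∕`hψ` on `negCone J_c`, and `hP3`; conclusion = per `i : MT`:
  `U i` open `∋ i`, the section `σ i` (cone-valued, `unif_B ∘ σ i = φT`, complex-differentiable on `U i`), `Φ i t = Π_{Z (σ i t)}` on `U i`,
  `IsRelExpChartOn … (U i) (Φ i) (ex i)`, (G) on `U i`, (ADM) on `U i` with `s := Z ∘ σ i` — token for token the four conjuncts of ★ P-3).

## References
* [Lange2023AbelianVarietiesComplex] H. Lange, *Abelian Varieties over the Complex Numbers* (2023), §3.4 Prop. 3.4.1 p. 186, Lemma 3.4.7 and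
  Prop. 3.4.8 pp. 189–191, Exercise 3.4.5 (7) p. 191.
* [BergeronMillsonMoeglin2016Balls] N. Bergeron, J. Millson, C. Moeglin, Acta Math. 216 (2016), Introduction §1.1, Part 2 §1.3.
* [FritzscheGrauert2002] K. Fritzsche, H. Grauert, *From Holomorphic Functions to Complex Manifolds* (2002), Ch. I §8 Thm. 8.5, Cor. 8.6.
* [SGA1] A. Grothendieck, SGA 1, LNM 224, Exp. XII (M. Raynaud) 1.2 pp. 314–315.
-/

set_option autoImplicit false

noncomputable section

open CategoryTheory CategoryTheory.Limits AlgebraicGeometry Matrix Topology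
open scoped Manifold ContDiff Matrix.Norms.Elementwise
open Literature.AlgebraicGeometry.Motives (SchemeOver ComplexPoints AlgPoints specOver AbelianVariety CartierDivisor IsSmoothProjective)
open Literature.AlgebraicGeometry.AbelianSchemes (PolarizedAbelianSchemeWithLevel AbelianSchemeOver)
open Literature.AlgebraicGeometry.ShimuraVarieties (UnitaryBallUniformisationDatum negCone)
open Literature.Geometry.Kaehler (ComplexTorus)
open Literature.Geometry.Kaehler.ComplexTorus (cover)
open Literature.Geometry.ComplexAnalytic (IsRelExpChartOn totalOver basePoint)
open Literature.NumberTheory.Transcendental (IsAnalytification)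
open Literature.NumberTheory.Automorphic (siegelUpperHalfSpace)
open Literature.NumberTheory.Adeles (latticeOfGL)

namespace Literature.AlgebraicGeometry.ModuliOfAbelianVarieties

open SiegelModuli (jOfSiegel)

/-! ### §1 THE HEAD: P-3 on every section domain of the piece -/

/-- **COV-2 «UNIV-FAMILY CHART COVER OF A PIECE».**  In the setting of ★ P-3 `siegelUniversalFamilyUniformisation` (a Siegel fine moduli scheme
`𝓜`, a uniformised piece `(S_c, ι_c, unif_c)` with its (U2+)∕(U3) clauses, a smooth complex base `T` with `ψ : T ⟶ S_c`, analytifications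
`φT : MT → T(ℂ)` with charts on `Fin 1 → ℂ` and `φA : MA → P_T.A(ℂ)`), let `T` be a compact DISC QUOTIENT (`B : UnitaryBallUniformisationDatum 1 T`
with cone `negCone J_c`) and `Z` a holomorphic `𝔥_g`-valued Siegel lift of `ψ` on the cone (`unif_c (Z v) = ψ (unif_B v)`, ★ E6-fac).  Then,
granted P-3, for EVERY point `i` of `MT` there are an open `U i ∋ i`, a holomorphic local section `σ i` of `unif_B` on `U i`
(★ `UnitaryBallUniformisationDatum.exists_siegelLift_nhds_of_isAnalytification`), and a relative exponential chart `(Φ i, ex i)` of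
`P_T.A^an → T^an` over `U i` with period family `Φ i t = Π_{Z (σ i t)}`, additive fibre analytifications, and admissible fibre markings by
`[J(Z (σ i t)), r]` with unit frame, tautological coordinates and torus map `=` chart fibre map — the four conjuncts of P-3 with `U := U i`,
`s := Z ∘ σ i`, token for token.  This is the chart-cover hypothesis list (`hex`, `hcov` via `i ∈ U i`, `hG`) of ★ E6-an′
`AbelianSchemeOver.exists_isMonHom_of_chartReadings_of_additive` at `(S := T, A := P_T.A)`, with the section data `(σ i)` feeding ★ COV-3∕4
`SiegelPeriodLinearAvatarFamily.exists_clm_family_along_lift` and the (ADM) data feeding ★ COV-5 `SiegelAdmissibleChartCompatibility`.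
[cite: Lange2023AbelianVarietiesComplex, Prop. 3.4.1 p. 186 + Lemma 3.4.7 + Prop. 3.4.8 pp. 189–191 + Ex. 3.4.5 (7) p. 191 (universality); cf. Thm. 3.1.2 p. 163]
[cite: BergeronMillsonMoeglin2016Balls, Introduction §1.1] [cite: FritzscheGrauert2002, Ch. I §8 Thm. 8.5 and Cor. 8.6] -/
theorem exists_univFamilyChartCover_of_piece (hP3 : siegelUniversalFamilyUniformisation)
    (g N : ℕ) (δ : Fin g → ℕ) (hg : 0 < g) (hδ : IsPolarizationType δ) (hN : 3 ≤ N) (𝓜 : SiegelFineModuliScheme g N δ)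
    -- a piece of `𝓜 ⊗ ℂ` with its uniformisation, satisfying the (U2+) clauses of ★ `siegelModuli_complexUniformisation`
    (c : (ZMod N)ˣ) (Sc : SchemeOver ℂ) (ιc : Sc ⟶ (Motives.baseChange ℚ ℂ).obj 𝓜.M)
    (unif : Matrix (Fin g) (Fin g) ℂ → ComplexPoints Sc)
    (unif_cont : ContinuousOn unif (siegelUpperHalfSpace g)) (unif_open : IsOpenMap ((siegelUpperHalfSpace g).restrict unif))
    (unif_surj : Set.SurjOn unif (siegelUpperHalfSpace g) Set.univ)
    (unif_iff : ∀ Z ∈ siegelUpperHalfSpace g, ∀ Z' ∈ siegelUpperHalfSpace g,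
      unif Z = unif Z' ↔ ∃ M ∈ siegelLevelGroup δ N, ∃ C : (Fin g → ℂ) ≃ₗ[ℂ] (Fin g → ℂ),
        ∀ v : Fin g ⊕ Fin g → ℝ, C (siegelPeriodMap δ Z v) = siegelPeriodMap δ Z' (intAct M v))
    (unif_hol : ∀ (V : Sc.left.affineOpens) (f : Sc.left.presheaf.obj (Opposite.op (↑V : Sc.left.Opens))),
      DifferentiableOn ℂ (fun Z ↦ AlgPoints.evalOrZero (↑V : Sc.left.Opens) f (unif Z))
        (siegelUpperHalfSpace g ∩ unif ⁻¹' {P | P.pt ∈ (↑V : Sc.left.Opens)}))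
    -- the (U3) junction for this piece: fibre identification (U3∃) and classification (U3-D3) at every `Z ∈ 𝔥_g`
    (junction : ∀ (u : finAdeleQˣ) (r : gspFinAdelic δ),
      (∀ v, Valued.v ((u : finAdeleQ) v) = 1) →
      (u : finAdeleQ) - ((c : ZMod N).val : ℕ) ∈ levelIdeal N →
      r ∈ principalLevelSubgroup δ 1 →
      IsMultiplier (typeFormOver δ finAdeleQ) (r : GL (Fin g ⊕ Fin g) finAdeleQ) u →
      ((r : GL (Fin g ⊕ Fin g) finAdeleQ) : Matrix (Fin g ⊕ Fin g) (Fin g ⊕ Fin g) finAdeleQ) =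
        Matrix.fromBlocks 1 0 0 ((u : finAdeleQ) • (1 : Matrix (Fin g) (Fin g) finAdeleQ)) →
      ∀ (Z : Matrix (Fin g) (Fin g) ℂ) (hZ : Z ∈ siegelUpperHalfSpace g),
        haveI : IsLocallyNoetherian (specOver ℚ ℂ).left :=
          inferInstanceAs (IsLocallyNoetherian (Spec (CommRingCat.of ℂ)))
        (∃ (P' : PolarizedAbelianSchemeWithLevel g N δ (specOver ℚ ℂ).left)
            (G : P'.A.X.left ⟶ 𝓜.univ.A.X.left) (Ĝ : P'.D.hat.X.left ⟶ 𝓜.univ.D.hat.X.left),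
            P'.IsBaseChangeVia 𝓜.univ
                ((AlgPoints.baseChangeEquiv (algebraMap ℚ ℂ) 𝓜.M).symm (AlgPoints.map ιc (unif Z))).left G Ĝ ∧
            IsAdmissibleAt hδ r Z hZ P') ∧
        (∀ (P' : PolarizedAbelianSchemeWithLevel g N δ (specOver ℚ ℂ).left), IsAdmissibleAt hδ r Z hZ P' →
            AlgPoints.map ιc (unif Z)
              = AlgPoints.baseChangeEquiv (algebraMap ℚ ℂ) 𝓜.M (𝓜.classifyingMap (specOver ℚ ℂ) P')))
    -- the piece: a compact disc quotient `T` over the Siegel piece, and its slice morphism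
    (T : SchemeOver ℂ) (B : UnitaryBallUniformisationDatum 1 T) {Jc : Matrix (Fin 2) (Fin 2) ℂ} (hB : B.Hℂ = Jc) (ψ : T ⟶ Sc)
    -- the holomorphic Siegel lift of `ψ` on the negative cone (★ E6-fac clause 1)
    (Z : (Fin 2 → ℂ) → Matrix (Fin g) (Fin g) ℂ) (Z_hol : ∀ i j, DifferentiableOn ℂ (fun v => Z v i j) (negCone Jc))
    (Z_mem : ∀ v, v ∈ negCone Jc → Z v ∈ siegelUpperHalfSpace g)
    (hψ : ∀ v, v ∈ negCone Jc → AlgPoints.map ψ (B.unif v) = unif (Z v))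
    -- analytifications of `T` (charts on `ℂ`) and of the total space of the pulled-back abelian scheme
    (MT : Type) [TopologicalSpace MT] [ChartedSpace (Fin 1 → ℂ) MT] [IsManifold 𝓘(ℂ, Fin 1 → ℂ) ω MT]
    (φT : MT → ComplexPoints T) (hT : IsAnalytification (Fin 1 → ℂ) T 1 φT)
    (MA : Type) [TopologicalSpace MA] [ChartedSpace (Fin (1 + g) → ℂ) MA] [IsManifold 𝓘(ℂ, Fin (1 + g) → ℂ) ω MA]
    (φA : MA → ComplexPoints (totalOver T
      (𝓜.univ.baseChange (ψ.left ≫ ιc.left ≫ pullback.fst 𝓜.M.hom (Spec.map (CommRingCat.ofHom (algebraMap ℚ ℂ))))).A))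
    (hA : IsAnalytification (Fin (1 + g) → ℂ) (totalOver T
      (𝓜.univ.baseChange (ψ.left ≫ ιc.left ≫ pullback.fst 𝓜.M.hom (Spec.map (CommRingCat.ofHom (algebraMap ℚ ℂ))))).A) (1 + g) φA) :
    letI P := 𝓜.univ.baseChange (ψ.left ≫ ιc.left ≫ pullback.fst 𝓜.M.hom (Spec.map (CommRingCat.ofHom (algebraMap ℚ ℂ))))
    ∃ (U : MT → Set MT) (σ : MT → MT → (Fin 2 → ℂ))
      (Φ : MT → MT → ((Fin g ⊕ Fin g → ℝ) ≃L[ℝ] (Fin g → ℂ))) (ex : MT → MT × (Fin g → ℂ) → MA),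
      -- the section domains cover `MT`
      (∀ i, IsOpen (U i)) ∧ (∀ i, i ∈ U i) ∧
      -- the sections: cone-valued, lifting `φT` through `unif_B`, complex-differentiable on `U i`
      (∀ i, ∀ t ∈ U i, σ i t ∈ negCone Jc ∧ B.unif (σ i t) = φT t) ∧
      (∀ i, ∀ t ∈ U i, MDifferentiableAt 𝓘(ℂ, Fin 1 → ℂ) 𝓘(ℂ, Fin 2 → ℂ) (σ i) t) ∧
      -- the period family is the tautological one along the lift `Z ∘ σ i`
      (∀ i, ∀ t ∈ U i, ∀ v : Fin g ⊕ Fin g → ℝ, Φ i t v = siegelPeriodMap δ (Z (σ i t)) v) ∧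
      -- (C) the charts
      (∀ i, IsRelExpChartOn (Fin 1 → ℂ) (Fin (1 + g) → ℂ) (basePoint hT P.A φA) (U i) (Φ i) (ex i)) ∧
      -- (G) the fibre maps are additive analytifications of the fibres, read in the total space
      (∀ i, ∀ t ∈ U i, ∃ φt : ComplexTorus (Φ i t) → (P.A.fibre (φT t).left).toAbelianVariety.Points ℂ,
        IsAnalytification (Fin g → ℂ) (P.A.fibre (φT t).left).toAbelianVariety.X g φt ∧
        (∀ x y, φt (x + y) = φt x * φt y) ∧
        ∀ z : Fin g → ℂ, (φA (ex i (t, z))).left = P.A.fibrePointToLeft (φT t).left (φt (cover (Φ i t) z))) ∧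
      -- (ADM) the fibre maps ARE admissible markings by `[J(Z (σ i t)), r]`, for every principal representative `r` of `c`
      (∀ i, ∀ (u : finAdeleQˣ) (r : gspFinAdelic δ),
        (∀ v, Valued.v ((u : finAdeleQ) v) = 1) →
        (u : finAdeleQ) - ((c : ZMod N).val : ℕ) ∈ levelIdeal N →
        r ∈ principalLevelSubgroup δ 1 →
        IsMultiplier (typeFormOver δ finAdeleQ) (r : GL (Fin g ⊕ Fin g) finAdeleQ) u →
        ((r : GL (Fin g ⊕ Fin g) finAdeleQ) : Matrix (Fin g ⊕ Fin g) (Fin g ⊕ Fin g) finAdeleQ) =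
          Matrix.fromBlocks 1 0 0 ((u : finAdeleQ) • (1 : Matrix (Fin g) (Fin g) finAdeleQ)) →
        ∀ (t : MT) (ht : t ∈ U i),
          ∃ (hZt : Z (σ i t) ∈ siegelUpperHalfSpace g)
            (m : SiegelAdelicMarking ⟨jOfSiegel δ (Z (σ i t)), SiegelComplexRecordSystem.jOfSiegel_mem_C0pm hδ.1 hZt⟩ r
              (P.A.fibre (φT t).left).toAbelianVariety)
            (Θ : CartierDivisor (P.A.fibre (φT t).left).toAbelianVariety.X.left)
            (Λ : P.level.SymplecticLift (φT t).left Θ δ),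
            Θ.IsAmple ∧ P.A.IsLambdaOfAt (φT t).left P.D P.pol.lam Θ ∧
            (∀ ⦃M : ℕ⦄, N ∣ M → M ≠ 0 → ∀ (x : Fin g ⊕ Fin g → ZMod M) (v : Fin g ⊕ Fin g → ℚ),
              AdelicCongr ((r⁻¹ : gspFinAdelic δ) : GL (Fin g ⊕ Fin g) finAdeleQ) 1 v (fun i => ((x i).val : ℚ) / M) →
                ((Λ.lift M (Multiplicative.ofAdd x)) : (P.A.fibre (φT t).left).toAbelianVariety.Points ℂ) = m.r v) ∧
            m.γ = 1 ∧ (∀ v : Fin g ⊕ Fin g → ℝ, m.Ψ v = siegelPeriodMap δ (Z (σ i t)) v) ∧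
            ∀ z : Fin g → ℂ, P.A.fibrePointToLeft (φT t).left (m.toFun (cover m.Ψ z)) = (φA (ex i (t, z))).left) := by
  let P := 𝓜.univ.baseChange (ψ.left ≫ ιc.left ≫ pullback.fst 𝓜.M.hom (Spec.map (CommRingCat.ofHom (algebraMap ℚ ℂ))))
  -- instances on the disc quotient `T`: smooth of relative dimension `1`, proper (hence separated, locally of finite type)
  have hX : IsSmoothProjective 1 T := B.isSmoothProjective
  haveI : SmoothOfRelativeDimension 1 T.hom := hX.smoothOfRelativeDimension
  haveI : IsProper T.hom := IsSmoothProjective.isProper_holds hX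
  haveI : IsSeparated T.hom := inferInstance
  haveI : LocallyOfFiniteType T.hom := inferInstance
  -- the cone of `B` is the negative cone of `J_c`
  have hcone : B.cone = negCone Jc := by
    change negCone B.Hℂ = negCone Jc
    rw [hB]
  -- §5 of ★ `UnitaryBallUniformisationLocalSectionAnalytification`: section + lift data at every point of `MT`
  have hsec : ∀ i : MT, ∃ (U : Set MT) (σ : MT → (Fin (1 + 1) → ℂ)), IsOpen U ∧ i ∈ U ∧
      (∀ y ∈ U, σ y ∈ B.cone ∧ B.unif (σ y) = φT y) ∧
      (∀ y ∈ U, MDifferentiableAt 𝓘(ℂ, Fin 1 → ℂ) 𝓘(ℂ, Fin (1 + 1) → ℂ) σ y) ∧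
      (∀ y ∈ U, Z (σ y) ∈ siegelUpperHalfSpace g) ∧
      (∀ k j, MDifferentiableOn 𝓘(ℂ, Fin 1 → ℂ) 𝓘(ℂ, ℂ) (fun y => Z (σ y) k j) U) ∧
      ∀ y ∈ U, unif (Z (σ y)) = AlgPoints.map ψ (φT y) := fun i =>
    B.exists_siegelLift_nhds_of_isAnalytification hT Z (fun k j => by rw [hcone]; exact Z_hol k j)
      (fun v hv => Z_mem v (by rw [← hcone]; exact hv)) unif ψ (fun v hv => hψ v (by rw [← hcone]; exact hv)) i
  choose U σ hUo hiU hσ hσd hsmem hshol hslift using hsec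
  -- ★ P-3 on each section domain `U i` with the lift `s := Z ∘ σ i`
  have hP : ∀ i : MT, ∃ (Φ : MT → ((Fin g ⊕ Fin g → ℝ) ≃L[ℝ] (Fin g → ℂ))) (ex : MT × (Fin g → ℂ) → MA),
      (∀ t ∈ U i, ∀ v : Fin g ⊕ Fin g → ℝ, Φ t v = siegelPeriodMap δ (Z (σ i t)) v) ∧
      IsRelExpChartOn (Fin 1 → ℂ) (Fin (1 + g) → ℂ) (basePoint hT P.A φA) (U i) Φ ex ∧
      (∀ t ∈ U i, ∃ φt : ComplexTorus (Φ t) → (P.A.fibre (φT t).left).toAbelianVariety.Points ℂ,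
        IsAnalytification (Fin g → ℂ) (P.A.fibre (φT t).left).toAbelianVariety.X g φt ∧
        (∀ x y, φt (x + y) = φt x * φt y) ∧
        ∀ z : Fin g → ℂ, (φA (ex (t, z))).left = P.A.fibrePointToLeft (φT t).left (φt (cover (Φ t) z))) ∧
      (∀ (u : finAdeleQˣ) (r : gspFinAdelic δ),
        (∀ v, Valued.v ((u : finAdeleQ) v) = 1) →
        (u : finAdeleQ) - ((c : ZMod N).val : ℕ) ∈ levelIdeal N →
        r ∈ principalLevelSubgroup δ 1 →
        IsMultiplier (typeFormOver δ finAdeleQ) (r : GL (Fin g ⊕ Fin g) finAdeleQ) u →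
        ((r : GL (Fin g ⊕ Fin g) finAdeleQ) : Matrix (Fin g ⊕ Fin g) (Fin g ⊕ Fin g) finAdeleQ) =
          Matrix.fromBlocks 1 0 0 ((u : finAdeleQ) • (1 : Matrix (Fin g) (Fin g) finAdeleQ)) →
        ∀ (t : MT) (ht : t ∈ U i),
          ∃ (m : SiegelAdelicMarking ⟨jOfSiegel δ (Z (σ i t)), SiegelComplexRecordSystem.jOfSiegel_mem_C0pm hδ.1 (hsmem i t ht)⟩ r
                (P.A.fibre (φT t).left).toAbelianVariety)
            (Θ : CartierDivisor (P.A.fibre (φT t).left).toAbelianVariety.X.left)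
            (Λ : P.level.SymplecticLift (φT t).left Θ δ),
            Θ.IsAmple ∧ P.A.IsLambdaOfAt (φT t).left P.D P.pol.lam Θ ∧
            (∀ ⦃M : ℕ⦄, N ∣ M → M ≠ 0 → ∀ (x : Fin g ⊕ Fin g → ZMod M) (v : Fin g ⊕ Fin g → ℚ),
              AdelicCongr ((r⁻¹ : gspFinAdelic δ) : GL (Fin g ⊕ Fin g) finAdeleQ) 1 v (fun i => ((x i).val : ℚ) / M) →
                ((Λ.lift M (Multiplicative.ofAdd x)) : (P.A.fibre (φT t).left).toAbelianVariety.Points ℂ) = m.r v) ∧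
            m.γ = 1 ∧ (∀ v : Fin g ⊕ Fin g → ℝ, m.Ψ v = siegelPeriodMap δ (Z (σ i t)) v) ∧
            ∀ z : Fin g → ℂ, P.A.fibrePointToLeft (φT t).left (m.toFun (cover m.Ψ z)) = (φA (ex (t, z))).left) := fun i =>
    hP3 g N δ hg hδ hN 𝓜 c Sc ιc unif unif_cont unif_open unif_surj unif_iff unif_hol junction T 1 ψ MT φT hT MA φA hA
      (U i) (hUo i) (fun t => Z (σ i t)) (hsmem i) (hshol i) (hslift i)
  choose Φ ex hΦ hex hG hADM using hP
  refine ⟨U, σ, Φ, ex, hUo, hiU, fun i t ht => ?_, hσd, hΦ, hex, hG, fun i u r hu huc hr hmult hrmat t ht => ?_⟩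
  · have h := hσ i t ht
    rw [hcone] at h
    exact h
  · obtain ⟨m, Θ, Λ, h⟩ := hADM i u r hu huc hr hmult hrmat t ht
    exact ⟨hsmem i t ht, m, Θ, Λ, h⟩

end Literature.AlgebraicGeometry.ModuliOfAbelianVarieties

end
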